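import Literature.AlgebraicGeometry.Tropical.TropicalTorusWeilCycles
import HarnessLib

/-!
# Crux `FormalCycleCriterion` (stmt-HodgeConjecture-18571), line `birth` — linear algebra and
# topology for stub 1 `stub_formalFamily` (Kontsevich's formal cycle)

Route `TropicalKugaSatakeCayley` of `HodgeConjecture`. Self-contained lemmas used by the proof of
the registered stub `stub_formalFamily` (file
`TropicalKugaSatakeCayleyFormalCycleCriterionFormalFamily`):

* `exists_generalizedInverse` — every rational matrix `M` has a generalized inverse `G`
  (`M G M = M`): a linear section of `M` onto its range, extended to the whole space.
* `mulVec_section_of_linearIndependent` — RATIONAL SOLVABILITY PROPAGATES FROM A `ℚ`-GENERIC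
  PARAMETER: if the real system `M x = N t` (`M`, `N` rational matrices) is solvable at one parameter
  `t ∈ ℝ^m` with `ℚ`-linearly independent coordinates, then `x(t') = G N t'` solves `M x = N t'` for
  EVERY `t'` (the obstruction `(M G - 1) N` is a rational matrix annihilating `t`, hence zero).
* `isOpen_setOf_posDef` — positive definiteness is an open condition along a continuous family of
  symmetric real matrices (minimum of the quadratic form on the compact unit sphere, tube lemma).

## References

* [Zharkov2020TropicalWeil] I. Zharkov, Tropical abelian varieties, Weil classes and the Hodge
  conjecture, arXiv:2002.02347 (2020), p. 3 (cycles varying rationally with the parameters).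
-/

noncomputable section

-- `Summit.HodgeConjecture.HodgeConjecture.…` is the mandated namespace (single-conjunct summit).
set_option linter.dupNamespace false

open scoped BigOperators
open Matrix

namespace Summit.HodgeConjecture.HodgeConjecture.Theorems.FormalCycleCriterion

/-! ### Generalized inverses of rational matrices -/

/-- **Generalized inverse.** Every matrix `M` over `ℚ` admits `G` with `M · G · M = M`: take a
linear right inverse of `M` onto its range and extend it linearly to the whole target space.
[folklore] -/
theorem exists_generalizedInverse {ι κ : Type*} [Fintype ι] [Fintype κ] [DecidableEq ι]
    [DecidableEq κ] (M : Matrix ι κ ℚ) : ∃ G : Matrix κ ι ℚ, M * G * M = M := by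
  let f : (κ → ℚ) →ₗ[ℚ] (ι → ℚ) := Matrix.toLin' M
  obtain ⟨s, hs⟩ := f.rangeRestrict.exists_rightInverse_of_surjective f.range_rangeRestrict
  obtain ⟨g, hg⟩ := LinearMap.exists_extend s
  refine ⟨LinearMap.toMatrix' g, ?_⟩
  have hfgf : f.comp (g.comp f) = f := by
    apply LinearMap.ext
    intro v
    have h1 : g (f v) = s ⟨f v, LinearMap.mem_range_self f v⟩ := by
      have := LinearMap.congr_fun hg ⟨f v, LinearMap.mem_range_self f v⟩
      simpa using this
    have h2 : f (s ⟨f v, LinearMap.mem_range_self f v⟩) = f v := by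
      have := LinearMap.congr_fun hs ⟨f v, LinearMap.mem_range_self f v⟩
      simpa using congrArg Subtype.val this
    simp only [LinearMap.comp_apply, h1, h2]
  calc M * LinearMap.toMatrix' g * M
      = LinearMap.toMatrix' (f.comp (g.comp f)) := by
        rw [LinearMap.toMatrix'_comp, LinearMap.toMatrix'_comp, LinearMap.toMatrix'_toLin',
          Matrix.mul_assoc]
    _ = M := by rw [hfgf, LinearMap.toMatrix'_toLin']

/-! ### Solvability of a rational system at a `ℚ`-generic parameter propagates -/

/-- A rational matrix annihilating a vector with `ℚ`-linearly independent coordinates vanishes.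
[folklore] -/
theorem eq_zero_of_mulVec_eq_zero_of_linearIndependent {ι : Type*} [Fintype ι] {m : ℕ}
    (R : Matrix ι (Fin m) ℚ) (t : Fin m → ℝ) (ht : LinearIndependent ℚ t)
    (hR : (R.map ((↑) : ℚ → ℝ)) *ᵥ t = 0) : R = 0 := by
  ext e s
  have h := congr_fun hR e
  simp only [Matrix.mulVec, dotProduct, Matrix.map_apply, Pi.zero_apply] at h
  have h' : ∑ i, R e i • t i = 0 := by
    simpa only [Rat.smul_def] using h
  exact (Fintype.linearIndependent_iff.1 ht (fun i => R e i) h') s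

/-- Casting a product of rational matrices to `ℝ`. [folklore] -/
theorem map_ratCast_mul {α β γ : Type*} [Fintype β] (A : Matrix α β ℚ) (B : Matrix β γ ℚ) :
    (A * B).map ((↑) : ℚ → ℝ) = A.map ((↑) : ℚ → ℝ) * B.map ((↑) : ℚ → ℝ) :=
  Matrix.map_mul (f := Rat.castHom ℝ)

/-- **Rational solvability propagates from a `ℚ`-generic parameter.** Let `M`, `N` be rational
matrices, `G` a generalized inverse of `M`, and suppose the real system `M x = N t` has a solution
`x₀` at a parameter `t` whose coordinates are linearly independent over `ℚ`. Then for EVERY real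
parameter `t'`, `x = G N t'` solves `M x = N t'`. Proof: `(M G - 1) N t = (M G M - M) x₀ = 0`, and a
rational matrix killing the `ℚ`-generic `t` is zero, so `M G N = N`. [cite: Zharkov2020TropicalWeil, p. 3] -/
theorem mulVec_section_of_linearIndependent {ι κ : Type*} [Fintype ι] [Fintype κ] [DecidableEq ι]
    [DecidableEq κ] {m : ℕ} (M : Matrix ι κ ℚ) (G : Matrix κ ι ℚ) (hG : M * G * M = M)
    (N : Matrix ι (Fin m) ℚ) (t : Fin m → ℝ) (ht : LinearIndependent ℚ t) (x₀ : κ → ℝ)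
    (hx₀ : (M.map ((↑) : ℚ → ℝ)) *ᵥ x₀ = (N.map ((↑) : ℚ → ℝ)) *ᵥ t) (t' : Fin m → ℝ) :
    (M.map ((↑) : ℚ → ℝ)) *ᵥ ((G.map ((↑) : ℚ → ℝ)) *ᵥ ((N.map ((↑) : ℚ → ℝ)) *ᵥ t')) =
      (N.map ((↑) : ℚ → ℝ)) *ᵥ t' := by
  -- the rational obstruction `(M G N - N)` kills `t`, hence vanishes
  have hzero : M * G * N - N = 0 := by
    apply eq_zero_of_mulVec_eq_zero_of_linearIndependent _ t ht
    have e : (M * G * N - N).map ((↑) : ℚ → ℝ) =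
        M.map ((↑) : ℚ → ℝ) * G.map ((↑) : ℚ → ℝ) * N.map ((↑) : ℚ → ℝ) - N.map ((↑) : ℚ → ℝ) := by
      rw [Matrix.map_sub ((↑) : ℚ → ℝ) Rat.cast_sub, map_ratCast_mul, map_ratCast_mul]
    rw [e, Matrix.sub_mulVec, ← Matrix.mulVec_mulVec, ← Matrix.mulVec_mulVec, ← hx₀,
      Matrix.mulVec_mulVec, Matrix.mulVec_mulVec, ← map_ratCast_mul, ← map_ratCast_mul, hG,
      sub_self]
  have hMGN : M.map ((↑) : ℚ → ℝ) * G.map ((↑) : ℚ → ℝ) * N.map ((↑) : ℚ → ℝ) =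
      N.map ((↑) : ℚ → ℝ) := by
    rw [← map_ratCast_mul, ← map_ratCast_mul, sub_eq_zero.1 hzero]
  rw [Matrix.mulVec_mulVec, Matrix.mulVec_mulVec, hMGN]

/-! ### Positive definiteness is an open condition -/

/-- **The positive-definite locus of a continuous family of symmetric real matrices is open.** At
a point `v₀` of the locus the quadratic form has a positive minimum on the (compact) unit sphere,
and by the tube lemma stays positive on the sphere for all nearby parameters; homogeneity gives
positivity on all non-zero vectors. [folklore] -/
theorem isOpen_setOf_posDef {E : Type*} [TopologicalSpace E] {n : Type*} [Fintype n]
    [DecidableEq n] (B : E → Matrix n n ℝ) (hB : ∀ i j, Continuous fun v => B v i j)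
    (hsymm : ∀ v, (B v).IsHermitian) : IsOpen {v | (B v).PosDef} := by
  rw [isOpen_iff_mem_nhds]
  intro v₀ hv₀
  -- the quadratic form, jointly continuous in the parameter and the vector
  have hq : Continuous fun z : E × (n → ℝ) => z.2 ⬝ᵥ (B z.1 *ᵥ z.2) := by
    simp only [dotProduct, Matrix.mulVec]
    refine continuous_finsetSum _ fun i _ => ?_
    refine ((continuous_apply i).comp continuous_snd).mul ?_
    refine continuous_finsetSum _ fun j _ => ?_
    exact ((hB i j).comp continuous_fst).mul ((continuous_apply j).comp continuous_snd)
  -- positivity on the unit sphere persists near `v₀` (tube lemma over the compact sphere)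
  have hS : IsCompact (Metric.sphere (0 : n → ℝ) 1) := isCompact_sphere 0 1
  have hev : ∀ᶠ v in nhds v₀, ∀ y ∈ Metric.sphere (0 : n → ℝ) 1, 0 < y ⬝ᵥ (B v *ᵥ y) := by
    refine hS.eventually_forall_of_forall_eventually fun y hy => ?_
    have hy0 : y ≠ 0 := by
      intro h
      rw [h, Metric.mem_sphere, dist_self] at hy
      exact zero_ne_one hy
    have hpos : 0 < y ⬝ᵥ (B v₀ *ᵥ y) := by
      have := (Matrix.posDef_iff_dotProduct_mulVec.1 hv₀).2 hy0
      simpa using this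
    exact (continuous_const.continuousAt).eventually_lt (hq.continuousAt (x := (v₀, y))) hpos
  refine Filter.mem_of_superset hev fun v hv => ?_
  -- homogeneity: from the sphere to all non-zero vectors
  refine Matrix.posDef_iff_dotProduct_mulVec.2 ⟨hsymm v, fun x hx => ?_⟩
  have hnx : 0 < ‖x‖ := norm_pos_iff.2 hx
  have hmem : ‖x‖⁻¹ • x ∈ Metric.sphere (0 : n → ℝ) 1 := by
    rw [mem_sphere_zero_iff_norm, norm_smul, norm_inv, norm_norm, inv_mul_cancel₀ hnx.ne']
  have h := hv _ hmem
  rw [Matrix.mulVec_smul, dotProduct_smul, smul_dotProduct, smul_smul] at h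
  have h' : 0 < (‖x‖⁻¹ * ‖x‖⁻¹) * (x ⬝ᵥ (B v *ᵥ x)) := by simpa [smul_eq_mul] using h
  have hxx : 0 < x ⬝ᵥ (B v *ᵥ x) :=
    pos_of_mul_pos_right h' (mul_nonneg (inv_nonneg.2 hnx.le) (inv_nonneg.2 hnx.le))
  simpa using hxx

end Summit.HodgeConjecture.HodgeConjecture.Theorems.FormalCycleCriterion

end
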